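import Summits.BirchSwinnertonDyer.BirchSwinnertonDyer.Theorems.ManinLocalTwoThreeTypeThreePsiThreeNewtonPolygon
import HarnessLib

/-!
# E-imc-71 `TypeThreeSubgroupCharacterUnramified` and E-imc-76u `TameThreeIIIAtMostOneLocalLine` HOLD:
# the tame-`3` laws of a Kodaira type `III` prime (`9 ∥ N`, `v₃ Δ_min = 3`)

Summit `BirchSwinnertonDyer`, route `ManinLocalTwoThree` (cell bsd-f2-manin), crux C3 `ManinPrimeToThreeAtNine`
(stmt-BirchSwinnertonDyer-22968), the `W[3]`-reducible shallow-`III` residual / (OTA₃).  This file proves BY NAME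
the two `@[conjecture]` rows of `Summits/BirchSwinnertonDyer/Rank1Residual/ManinAdditive/TypeThreeSubgroupCharacter.lean`
(imc g13d MEMO-imc §19.15 and refuter-1 §R54 gap-fill of imc g14 MEMO-imc §20.4; both «NOT in print as stated,
theorem-grade, elementary» per refuter-1 §R52/§R54):

* `TameThreeIIIAtMostOneLocalLine_holds` — E-imc-76u: on a global minimal model with `9 ∥ N` and
  `v₃ Δ_min = 3` the `3`-division quartic `Ψ₃` has AT MOST ONE root in `ℚ₃` (`E[3]` has at most one
  `G_{ℚ₃}`-stable line; census 77 415 / 77 415);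
* `TypeThreeSubgroupCharacterUnramified_holds` — E-imc-71: a RATIONAL `3`-subgroup abscissa `x₀` has Kummer
  discriminant `D₀ = ψ₂(x₀)²` of even (indeed zero) `3`-adic valuation and `−3·D₀` is not a square (the
  subgroup's character is unramified at `3` and the subgroup is not `μ₃`; census 8 650 / 8 650).

Proof = the Newton polygon of `ψ₃` on the integer `III`-shape translate (sibling TOOL file
`ManinLocalTwoThreeTypeThreePsiThreeNewtonPolygon.lean`): `ψ₃^W(x) = F(x − r)`, `F = 3z⁴ + 3βz³ + 9γz² + 27δz + 9ε`,
`3 ∤ ε`; every `ℚ₃`-root of `F` is a `3`-adic unit, two unit roots coincide, and `D₀ = 4z³ + 3βz² + 6γz + 9δ`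
is a `3`-adic unit at a unit `z`.

No new definitions, no named fact, no sorry.  HONEST FRAMING: these are local lemmas at `3` (the cell's own
rows); nothing about BSD or Manin's conjecture is proved here; C3 remains open.

References: J. H. Silverman, *ATAEC* IV.9.4 Steps 2–4 and Table 4.1 [cite: SilvermanATAEC1994, IV.9.4 and Table 4.1];
nearest print for the `III ↔ III*` flip: T. and V. Dokchitser, *Local invariants of isogenous elliptic curves*,
Cor. 8 / Thm. 22 (arXiv:1208.5519); cell memos HOME/MEMO-imc.md §19.15, §20.4, HOME/REFUTER-ref1.md §R52, §R54.
-/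

set_option linter.dupNamespace false

noncomputable section

open scoped Classical

open WeierstrassCurve Summit.BirchSwinnertonDyer.Rank1Residual.ManinAdditive.TameThreeCharacter

namespace Summit.BirchSwinnertonDyer.BirchSwinnertonDyer.Theorems.ManinLocalTwoThree

/-- Numerals pass through the coercion `ℤ₃ → ℚ₃` (companion of Mathlib's `PadicInt.coe_natCast`). -/
private theorem coe_ofNat_three (n : ℕ) [n.AtLeastTwo] :
    ((ofNat(n) : ℤ_[3]) : ℚ_[3]) = ofNat(n) := rfl

/-- For a rational `q`, `|q|₃ = 1` means `q ≠ 0` and `ord₃ q = 0`. -/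
private theorem padicValRat_eq_zero_of_norm_eq_one {q : ℚ} (h : ‖(q : ℚ_[3])‖ = 1) :
    q ≠ 0 ∧ padicValRat 3 q = 0 := by
  have hq : q ≠ 0 := by
    rintro rfl; norm_num at h
  have hq' : (q : ℚ_[3]) ≠ 0 := by exact_mod_cast hq
  rw [Padic.norm_eq_zpow_neg_valuation hq', Padic.valuation_ratCast,
    zpow_eq_one_iff_right₀ (by norm_num) (by norm_num)] at h
  exact ⟨hq, by omega⟩

/-- **E-imc-76u `TameThreeIIIAtMostOneLocalLine` holds**: on a global minimal model with `9 ∥ N`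
and `v₃ Δ_min = 3` (Kodaira type `III` at `3`), the `3`-division quartic `Ψ₃` has at most one root
in `ℚ₃` — `E[3]` has at most one `G_{ℚ₃}`-stable line.  Proof: on the integer `III`-shape translate
(`x ↦ x + r`) `Ψ₃ = 3z⁴ + 3βz³ + 9γz² + 27δz + 9ε` with `3 ∤ ε`; its Newton polygon has exactly one
vertex of slope `0`: every `ℚ₃`-root is a `3`-adic unit `≡ −β (mod 3)`, and two unit roots coincide
(`ℤ₃` a domain, the difference quotient `≡ 4z³ (mod 3)` a unit).  Cell bsd-f2-manin, refuter-1 §R54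
gap-fill of imc g14 MEMO-imc §20.4 (census 77 415 / 77 415); bears on crux C3 `ManinPrimeToThreeAtNine`
(stmt-BirchSwinnertonDyer-22968), (OTA₃) plane case.  Nothing about BSD or Manin's conjecture is
proved here. [cite: SilvermanATAEC1994, IV.9.4 Steps 2–4 and Table 4.1 (Tate's algorithm at 3, type III)] -/
theorem TameThreeIIIAtMostOneLocalLine_holds : TameThreeIIIAtMostOneLocalLine := by
  intro W _ _ h9 h27 hΔ x y hx hy
  obtain ⟨r, β, γ, δ, ε, hε, e₂, e₄, e₆, e₈⟩ := exists_IIIShape_coeffs_three W h9 h27 hΔ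
  unfold IsLocalThreeSubgroupX at hx hy
  rw [e₂, e₄, e₆, e₈] at hx hy
  push_cast at hx hy
  have hx' : 3 * (x - r) ^ 4 + 3 * (β : ℚ_[3]) * (x - r) ^ 3 + 9 * (γ : ℚ_[3]) * (x - r) ^ 2
      + 27 * (δ : ℚ_[3]) * (x - r) + 9 * (ε : ℚ_[3]) = 0 := by
    linear_combination hx
  have hy' : 3 * (y - r) ^ 4 + 3 * (β : ℚ_[3]) * (y - r) ^ 3 + 9 * (γ : ℚ_[3]) * (y - r) ^ 2
      + 27 * (δ : ℚ_[3]) * (y - r) + 9 * (ε : ℚ_[3]) = 0 := by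
    linear_combination hy
  have hnx := norm_eq_one_of_psi3III_root hε hx'
  have hny := norm_eq_one_of_psi3III_root hε hy'
  set zx : ℤ_[3] := ⟨x - r, hnx.le⟩ with hzxdef
  set zy : ℤ_[3] := ⟨y - r, hny.le⟩ with hzydef
  have hcx : (zx : ℚ_[3]) = x - r := rfl
  have hcy : (zy : ℚ_[3]) = y - r := rfl
  have hux : IsUnit zx := PadicInt.isUnit_iff.mpr hnx
  have huy : IsUnit zy := PadicInt.isUnit_iff.mpr hny
  have hzx : 3 * zx ^ 4 + 3 * (β : ℤ_[3]) * zx ^ 3 + 9 * (γ : ℤ_[3]) * zx ^ 2 + 27 * (δ : ℤ_[3]) * zx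
      + 9 * (ε : ℤ_[3]) = 0 := by
    rw [← PadicInt.coe_eq_zero]; push_cast [hcx]; exact hx'
  have hzy : 3 * zy ^ 4 + 3 * (β : ℤ_[3]) * zy ^ 3 + 9 * (γ : ℤ_[3]) * zy ^ 2 + 27 * (δ : ℤ_[3]) * zy
      + 9 * (ε : ℤ_[3]) = 0 := by
    rw [← PadicInt.coe_eq_zero]; push_cast [hcy]; exact hy'
  have heq := eq_of_psi3III_roots hux huy hzx hzy
  have : (zx : ℚ_[3]) = zy := congrArg _ heq
  rw [hcx, hcy] at this
  exact sub_left_injective this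

/-- **E-imc-71 `TypeThreeSubgroupCharacterUnramified` holds**: on a global minimal model with
`9 ∥ N` and `v₃ Δ_min = 3` (Kodaira type `III` at `3`), a rational subgroup of order `3` with
abscissa `x₀` (`ψ₃(x₀) = 0`) has Kummer discriminant `D₀ = ψ₂(x₀)² = 4x₀³ + b₂x₀² + 2b₄x₀ + b₆` of
EVEN `3`-adic valuation (indeed `ord₃ D₀ = 0`: on the integer `III`-shape translate `x₀ − r` is a
`3`-adic unit and `D₀ = 4z³ + 3βz² + 6γz + 9δ ≡ 4z³ (mod 3)`), so the character of the subgroup is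
unramified at `3`, and `−3·D₀` (odd valuation) is not a square — the subgroup is not `μ₃`.  Cell
bsd-f2-manin, imc g13d MEMO-imc §19.15 / refuter-1 §R52 (census 8 650 / 8 650; an §57.8 Lemma 1);
bears on crux C3 `ManinPrimeToThreeAtNine` (stmt-BirchSwinnertonDyer-22968), the `W[3]`-reducible
shallow-`III` residual.  Nothing about BSD or Manin's conjecture is proved here.
[cite: SilvermanATAEC1994, IV.9.4 Steps 2–4 and Table 4.1 (Tate's algorithm at 3, type III)] -/
theorem TypeThreeSubgroupCharacterUnramified_holds : TypeThreeSubgroupCharacterUnramified := by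
  intro W _ _ h9 h27 hΔ x₀ hx₀
  obtain ⟨r, β, γ, δ, ε, hε, e₂, e₄, e₆, e₈⟩ := exists_IIIShape_coeffs_three W h9 h27 hΔ
  unfold IsThreeSubgroupX at hx₀
  -- the root `x₀ − r` of the translated quartic, read in `ℚ₃`
  have hx' : 3 * (((x₀ : ℚ) : ℚ_[3]) - r) ^ 4 + 3 * (β : ℚ_[3]) * ((x₀ : ℚ_[3]) - r) ^ 3
      + 9 * (γ : ℚ_[3]) * ((x₀ : ℚ_[3]) - r) ^ 2 + 27 * (δ : ℚ_[3]) * ((x₀ : ℚ_[3]) - r)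
      + 9 * (ε : ℚ_[3]) = 0 := by
    have h := congrArg (fun q : ℚ ↦ (q : ℚ_[3])) hx₀
    simp only [e₂, e₄, e₆, e₈] at h
    push_cast at h
    linear_combination h
  have hn := norm_eq_one_of_psi3III_root hε hx'
  set z : ℤ_[3] := ⟨(x₀ : ℚ_[3]) - r, hn.le⟩ with hzdef
  have hcz : (z : ℚ_[3]) = (x₀ : ℚ_[3]) - r := rfl
  have hu : IsUnit z := PadicInt.isUnit_iff.mpr hn
  have hD := isUnit_disc_of_isUnit (β := β) (γ := γ) (δ := δ) hu
  -- `D₀` is that unit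
  have hD₀ : threeSubgroupDisc W x₀ =
      4 * (x₀ - r) ^ 3 + 3 * β * (x₀ - r) ^ 2 + 6 * γ * (x₀ - r) + 9 * δ := by
    unfold threeSubgroupDisc; rw [e₂, e₄, e₆]; ring
  have hnorm : ‖((threeSubgroupDisc W x₀ : ℚ) : ℚ_[3])‖ = 1 := by
    have e : ((threeSubgroupDisc W x₀ : ℚ) : ℚ_[3]) =
        ((4 * z ^ 3 + 3 * (β : ℤ_[3]) * z ^ 2 + 6 * (γ : ℤ_[3]) * z + 9 * (δ : ℤ_[3]) : ℤ_[3]) :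
          ℚ_[3]) := by
      rw [hD₀]; push_cast [hcz, coe_ofNat_three]; ring
    rw [e, ← PadicInt.norm_def]
    exact PadicInt.isUnit_iff.mp hD
  obtain ⟨hD0, hval⟩ := padicValRat_eq_zero_of_norm_eq_one hnorm
  refine ⟨by rw [hval]; exact Even.zero, ?_⟩
  rintro ⟨s, hs⟩
  have hs0 : s ≠ 0 := by
    rintro rfl
    exact (mul_ne_zero (by norm_num) hD0) (hs.trans (mul_zero 0))
  have h33 : padicValRat 3 (-3 : ℚ) = 1 := by
    rw [padicValRat.neg, show (3 : ℚ) = ((3 : ℕ) : ℚ) by norm_num, padicValRat.self (by norm_num)]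
  have hv := congrArg (padicValRat 3) hs
  rw [padicValRat.mul (by norm_num) hD0, padicValRat.mul hs0 hs0, hval, h33] at hv
  omega

end Summit.BirchSwinnertonDyer.BirchSwinnertonDyer.Theorems.ManinLocalTwoThree

end
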